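import Summits.NavierStokesRegularity.NavierStokesRegularity.Theorems.TypeILiouvilleTypeIliouvilleLWeakL3VanishingTail
import HarnessLib

/-!
# The persistent stub of crux `TypeIliouvilleL` (stmt-NavierStokesRegularity-10661) in WEAK-`L³` /
# VANISHING-TAIL currency: S3ʷ, its kill, and losslessness

Helper file (theorems only, no definition, no named fact, no `sorry`; lands
`--supports stmt-NavierStokesRegularity-10661`; no skeleton is touched — LAND-ONLY). The registered
persistent stub S3ᵐ (`stub_persistent_mild_backward_L3_recurrence`) asks that every persistent
(not Type-I decaying) member `v` of print's class P be `L³`-close (`≤ M`) to constants `b_k` along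
some `τ_k → −∞`; the skeleton then kills it with Albritton–Barker Thm 1.2 after propagating the
constants. The WEAKER CURRENCY S3ʷ below asks only for a uniform WEAK-`L³` bound of `v(τ_k) − b`
(ONE constant) plus a vanishing weak-`L³` lower tail at ONE index — the class containing the
`O(|x|⁻¹)` wakes is allowed along the sequence, only one slice must be `o`-weak-`L³` at large scales:

* `oseenMild_liouville_persistent_of_weakL3TailRecurrence` — **S3ʷ ⇒ (L) on the persistent part
  of class P** (by `oseenMild_const_of_backward_weakL3_const_of_tail`, i.e. Albritton–Barker Thm 4.1
  with both slice conditions discharged);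
* `weakL3TailRecurrence_of_oseenMild_liouville` — **losslessness**: (L) on class P ⇒ S3ʷ
  (constants recur trivially: `τ_k = −(k+1)`, `M = 0`).

So S3ʷ is, like S3ᵐ, EQUIVALENT to (L) restricted to persistent mild bounded ancient solutions, in
a weaker currency, and its composition needs no constant-propagation lemma. Restating the stub is
the planner's call; nothing here proves S3ᵐ, S3ʷ, (L), or anything about Navier–Stokes regularity.
-/

set_option linter.dupNamespace false

namespace Summit.NavierStokesRegularity.NavierStokesRegularity.Theorems

open MeasureTheory Filter Set Function Metric
open scoped ENNReal NNReal Topology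
open Literature.Analysis Literature.Analysis.FluidPDE

/-- **S3ʷ kills the persistent regime.** Suppose every persistent member of print's class P
(continuous, uniformly bounded on `(−∞,0) × ℝ³`, weakly divergence free, Oseen-mild, sup norm NOT
`O((−t)^{-1/2})`) admits ONE constant `b`, negative times `τ_k → −∞`, a finite `M` with
`s³·vol{s < ‖v(τ_k) − b‖} ≤ M` for all `s > 0`, `k`, and ONE index `k₀` with
`s³·vol{s < ‖v(τ_{k₀}) − b‖} → 0` as `s → 0⁺`. Then every persistent member of P is a constant
(`oseenMild_const_of_backward_weakL3_const_of_tail`). [cite: AlbrittonBarker2019, Thm 4.1 (arXiv:1811.00502 §4 p. 9)] -/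
theorem oseenMild_liouville_persistent_of_weakL3TailRecurrence
    (hS3w : ∀ v : ℝ → EuclideanSpace ℝ (Fin 3) → EuclideanSpace ℝ (Fin 3),
      ContinuousOn (uncurry v) (Iio 0 ×ˢ univ) →
      (∃ K : ℝ, ∀ t < 0, ∀ x, ‖v t x‖ ≤ K) →
      (∀ t < 0, IsWeaklyDivFree (v t)) →
      (∀ s t : ℝ, s < t → t < 0 → ∀ x,
        v t x = UnboundedOperators.heatExtension (v s) (t - s) x - oseenDuhamel 1 s v v t x) →
      (¬ ∃ C : ℝ, ∀ t < 0, ∀ x, ‖v t x‖ ≤ C / Real.sqrt (-t)) →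
      ∃ (b : EuclideanSpace ℝ (Fin 3)) (τ : ℕ → ℝ) (M : ℝ≥0) (k₀ : ℕ),
        (∀ k, τ k < 0) ∧ Tendsto τ atTop atBot ∧
        (∀ (k : ℕ) (s : ℝ), 0 < s →
          ENNReal.ofReal s ^ 3 *
            (volume : Measure (EuclideanSpace ℝ (Fin 3))) {x | s < ‖v (τ k) x - b‖} ≤ (M : ℝ≥0∞)) ∧
        Tendsto (fun s : ℝ => ENNReal.ofReal s ^ 3 *
            (volume : Measure (EuclideanSpace ℝ (Fin 3))) {x | s < ‖v (τ k₀) x - b‖})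
          (𝓝[>] 0) (𝓝 0))
    (v : ℝ → EuclideanSpace ℝ (Fin 3) → EuclideanSpace ℝ (Fin 3))
    (hvc : ContinuousOn (uncurry v) (Iio 0 ×ˢ univ))
    (hvK : ∃ K : ℝ, ∀ t < 0, ∀ x, ‖v t x‖ ≤ K)
    (hvd : ∀ t < 0, IsWeaklyDivFree (v t))
    (hvm : ∀ s t : ℝ, s < t → t < 0 → ∀ x,
      v t x = UnboundedOperators.heatExtension (v s) (t - s) x - oseenDuhamel 1 s v v t x)
    (hpers : ¬ ∃ C : ℝ, ∀ t < 0, ∀ x, ‖v t x‖ ≤ C / Real.sqrt (-t)) :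
    ∃ b : EuclideanSpace ℝ (Fin 3), ∀ t < 0, ∀ x, v t x = b := by
  obtain ⟨b, τ, M, k₀, hτ0, hτ, hwk, htail⟩ := hS3w v hvc hvK hvd hvm hpers
  exact ⟨b, oseenMild_const_of_backward_weakL3_const_of_tail v b hvc hvK hvd hvm
    (M := (M : ℝ≥0∞)) ENNReal.coe_lt_top hτ hτ0 hwk (k₀ := k₀) htail⟩

/-- **Losslessness of S3ʷ.** If (L) holds on print's class P (every member is a constant), then
S3ʷ holds: for a constant field `v ≡ b` the sets `{s < ‖v(τ_k) − b‖}` are empty for `s > 0`, so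
`τ_k = −(k+1)`, `M = 0`, `k₀ = 0` witness the weak-`L³` recurrence with vanishing tail. Hence S3ʷ
is implied by the crux (it cannot be false unless (L) is). [folklore] -/
theorem weakL3TailRecurrence_of_oseenMild_liouville
    (hL : ∀ v : ℝ → EuclideanSpace ℝ (Fin 3) → EuclideanSpace ℝ (Fin 3),
      ContinuousOn (uncurry v) (Iio 0 ×ˢ univ) →
      (∃ K : ℝ, ∀ t < 0, ∀ x, ‖v t x‖ ≤ K) →
      (∀ t < 0, IsWeaklyDivFree (v t)) →
      (∀ s t : ℝ, s < t → t < 0 → ∀ x,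
        v t x = UnboundedOperators.heatExtension (v s) (t - s) x - oseenDuhamel 1 s v v t x) →
      ∃ b : EuclideanSpace ℝ (Fin 3), ∀ t < 0, ∀ x, v t x = b)
    (v : ℝ → EuclideanSpace ℝ (Fin 3) → EuclideanSpace ℝ (Fin 3))
    (hvc : ContinuousOn (uncurry v) (Iio 0 ×ˢ univ))
    (hvK : ∃ K : ℝ, ∀ t < 0, ∀ x, ‖v t x‖ ≤ K)
    (hvd : ∀ t < 0, IsWeaklyDivFree (v t))
    (hvm : ∀ s t : ℝ, s < t → t < 0 → ∀ x,
      v t x = UnboundedOperators.heatExtension (v s) (t - s) x - oseenDuhamel 1 s v v t x)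
    (_hpers : ¬ ∃ C : ℝ, ∀ t < 0, ∀ x, ‖v t x‖ ≤ C / Real.sqrt (-t)) :
    ∃ (b : EuclideanSpace ℝ (Fin 3)) (τ : ℕ → ℝ) (M : ℝ≥0) (k₀ : ℕ),
      (∀ k, τ k < 0) ∧ Tendsto τ atTop atBot ∧
      (∀ (k : ℕ) (s : ℝ), 0 < s →
        ENNReal.ofReal s ^ 3 *
          (volume : Measure (EuclideanSpace ℝ (Fin 3))) {x | s < ‖v (τ k) x - b‖} ≤ (M : ℝ≥0∞)) ∧
      Tendsto (fun s : ℝ => ENNReal.ofReal s ^ 3 *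
          (volume : Measure (EuclideanSpace ℝ (Fin 3))) {x | s < ‖v (τ k₀) x - b‖})
        (𝓝[>] 0) (𝓝 0) := by
  obtain ⟨b, hb⟩ := hL v hvc hvK hvd hvm
  -- the superlevel sets of `v(t) − b ≡ 0` are empty at positive levels
  have hempty : ∀ t : ℝ, t < 0 → ∀ s : ℝ, 0 < s →
      {x : EuclideanSpace ℝ (Fin 3) | s < ‖v t x - b‖} = ∅ := by
    intro t ht s hs
    ext x
    simp only [mem_setOf_eq, mem_empty_iff_false, iff_false, not_lt, hb t ht x, sub_self, norm_zero]
    exact hs.le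
  have hτ : Tendsto (fun k : ℕ => -((k : ℝ) + 1)) atTop atBot :=
    tendsto_neg_atTop_atBot.comp (tendsto_atTop_add_const_right _ 1 tendsto_natCast_atTop_atTop)
  have hτ0 : ∀ k : ℕ, -((k : ℝ) + 1) < 0 := fun k => by
    have : (0 : ℝ) ≤ k := Nat.cast_nonneg k
    linarith
  refine ⟨b, fun k => -((k : ℝ) + 1), 0, 0, hτ0, hτ, ?_, ?_⟩
  · intro k s hs
    rw [hempty _ (hτ0 k) s hs, measure_empty, mul_zero]
    exact zero_le
  · refine (tendsto_const_nhds (x := (0 : ℝ≥0∞))).congr' ?_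
    refine eventually_nhdsWithin_of_forall fun s hs => ?_
    simp only [hempty _ (hτ0 0) s hs, measure_empty, mul_zero]

end Summit.NavierStokesRegularity.NavierStokesRegularity.Theorems
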